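import Summits.Ventures.PercRepro.ProfilePointedCircuitClassesStarSharpD0A
import Summits.Ventures.PercRepro.ProfilePointedCircuitClassesStarSharpD0F

/-!
# PercRepro — CASE D0 OF `StarNineSharp`, PART G: THE VOCABULARY OF THE FIVE-RULE INJECTION AND RULE R1
(p5, gen 54; `proofs/P5-GM1.md` §81 (c))

The conditions `d0c1` (`ρ(π + e + f) = 4`: the demand is off the ON plane `H`), `d0c2` (`X ∖ π` OFF), `d0c3`
(`π + f ∈ A`), `d0c4` (the triple `{w₀} ∪ π` gives a bi-basis whose complementary pair is not an ON demand) on an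
ON demand `W = π + e + b`, the family `d0DON` of ON demands, the data of an ON demand (`d0_demand_data`), its
classification (`d0_demand_class`: off `H` or `π ⊆ H`), and the injection of rule R1 (`d0_injR1`: the demands in
`H` with `π + f ∈ A` go to `π + f + b`, ON).  Parts H and I hold the other injections and the assembly.
-/

open scoped Matroid

namespace PercRepro.Cogirth

open Finset ThmH Skew Shadow Profile

open Classical

variable {α : Type} [DecidableEq α] {N : Matroid α} [N.Finite]

section StarSharpD0G

variable {b b' : α}

/-- The OFF-image test of a set `{e, f, x} + b`: it is `ρ(X − x) = 4 ∧ ρ({e, f, x} ∪ {b, b′}) = 5`. -/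
theorem off_image_efx_iff (h : SeriesPair N b b') (hn : (gr N).card = 9) {e f x : α} (he : e ∈ gr N)
    (hf : f ∈ gr N) (hef : e ≠ f) (heb : e ≠ b) (heb' : e ≠ b') (hfb : f ≠ b) (hfb' : f ≠ b')
    (hx : x ∈ ((((gr N).erase b).erase b').erase f).erase e) :
    (gr N \ insert b {e, f, x}).erase b' ∈ biIndepSets N 4 ↔
      rk N ((((((gr N).erase b).erase b').erase f).erase e).erase x) = 4 ∧
        rk N (insert b (insert b' {e, f, x})) = 5 := by
  have hb' : b' ∈ gr N := h.2.1; have hbb' : b ≠ b' := h.2.2.1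
  have hXE : ((((gr N).erase b).erase b').erase f).erase e ⊆ ((gr N).erase b).erase b' :=
    (erase_subset _ _).trans (erase_subset _ _)
  have hxE := hXE hx
  have hxe : x ≠ e := (mem_erase.1 hx).1
  have hxf : x ≠ f := (mem_erase.1 (mem_erase.1 hx).2).1
  have hS : ({e, f, x} : Finset α) ⊆ ((gr N).erase b).erase b' := by
    intro w hw; simp only [mem_insert, mem_singleton] at hw
    rcases hw with rfl | rfl | rfl
    · exact mem_erase.2 ⟨heb', mem_erase.2 ⟨heb, he⟩⟩
    · exact mem_erase.2 ⟨hfb', mem_erase.2 ⟨hfb, hf⟩⟩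
    · exact hxE
  have e1 : (gr N \ insert b {e, f, x}).erase b' = ((gr N).erase b).erase b' \ {e, f, x} := by
    rw [sdiff_insert_b_eq hb' hbb' hS, erase_insert (fun h' => (mem_erase.1 (mem_sdiff.1 h').1).1 rfl)]
  rw [e1, E7_sdiff_efx_eq]
  have hXc : (((((gr N).erase b).erase b').erase f).erase e).card = 5 := by
    have hE7 : (((gr N).erase b).erase b').card = 7 := by
      rw [card_erase_of_mem (mem_erase.2 ⟨hbb'.symm, hb'⟩), card_erase_of_mem h.1, hn]
    rw [card_erase_of_mem (mem_erase.2 ⟨hef, mem_erase.2 ⟨heb', mem_erase.2 ⟨heb, he⟩⟩⟩),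
      card_erase_of_mem (mem_erase.2 ⟨hfb', mem_erase.2 ⟨hfb, hf⟩⟩), hE7]
  have hc4 : ((((((gr N).erase b).erase b').erase f).erase e).erase x).card = 4 := by
    rw [card_erase_of_mem hx, hXc]
  rw [mem_biIndepSets_iff_of_subset_E7 h hn ((erase_subset _ _).trans hXE) hc4]
  have e2 : ((gr N).erase b).erase b' \ (((((gr N).erase b).erase b').erase f).erase e).erase x = {e, f, x} := by
    ext w
    constructor
    · intro hw
      obtain ⟨hwE, hwX⟩ := mem_sdiff.1 hw
      simp only [mem_insert, mem_singleton]
      by_cases hwx : w = x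
      · exact Or.inr (Or.inr hwx)
      by_cases hwe : w = e
      · exact Or.inl hwe
      by_cases hwf : w = f
      · exact Or.inr (Or.inl hwf)
      exact absurd (mem_erase.2 ⟨hwx, mem_erase.2 ⟨hwe, mem_erase.2 ⟨hwf, hwE⟩⟩⟩) hwX
    · intro hw
      simp only [mem_insert, mem_singleton] at hw
      rcases hw with rfl | rfl | rfl
      · exact mem_sdiff.2 ⟨mem_erase.2 ⟨heb', mem_erase.2 ⟨heb, he⟩⟩, fun h' => (mem_erase.1 (mem_erase.1 h').2).1 rfl⟩
      · exact mem_sdiff.2 ⟨mem_erase.2 ⟨hfb', mem_erase.2 ⟨hfb, hf⟩⟩,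
          fun h' => (mem_erase.1 (mem_erase.1 (mem_erase.1 h').2).2).1 rfl⟩
      · exact mem_sdiff.2 ⟨hxE, fun h' => (mem_erase.1 h').1 rfl⟩
  rw [e2]

/-- `ρ((insert f Y) ∪ {b, b′}) = 4` when `f ∈ cl(Y)` and `Y` is ON of rank `3`. -/
theorem on_insert_f_of_on {f : α} (hf : f ∈ gr N) (hfb : f ≠ b) (hfb' : f ≠ b')
    {Y : Finset α} (hYr : rk N Y = 3) (hfY : rk N (insert f Y) = 3)
    (hYon : rk N (insert b (insert b' Y)) = 4) : rk N (insert b (insert b' (insert f Y))) = 4 := by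
  have hfE : f ∈ ((gr N).erase b).erase b' := mem_erase.2 ⟨hfb', mem_erase.2 ⟨hfb, hf⟩⟩
  have e1 : insert b (insert b' (insert f Y)) = insert f (Y ∪ {b, b'}) := by
    ext x; simp only [mem_insert, mem_union, mem_singleton]; tauto
  have e2 : insert b (insert b' Y) = Y ∪ {b, b'} := by
    ext x; simp only [mem_insert, mem_union, mem_singleton]; tauto
  have h1 : rk N (insert f (Y ∪ {b, b'})) = rk N (Y ∪ {b, b'}) :=
    rk_insert_union_eq_of_rk_insert_eq' (by rw [hfY, hYr])
  rw [e1, h1, ← e2, hYon]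

/-- `X ∖ ((X ∖ π).erase w) = insert w π` for `π ⊆ X`, `w ∈ X ∖ π`. -/
theorem sdiff_sdiff_erase_eq {X π : Finset α} {w : α} (hπ : π ⊆ X) (hw : w ∈ X) (hwπ : w ∉ π) :
    X \ (X \ π).erase w = insert w π := by
  ext x
  constructor
  · intro hx
    obtain ⟨hxX, hx2⟩ := mem_sdiff.1 hx
    rw [mem_insert]
    by_cases hxw : x = w
    · exact Or.inl hxw
    · right
      by_contra hxπ
      exact hx2 (mem_erase.2 ⟨hxw, mem_sdiff.2 ⟨hxX, hxπ⟩⟩)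
  · intro hx
    rw [mem_insert] at hx
    rcases hx with rfl | hxπ
    · exact mem_sdiff.2 ⟨hw, fun h' => (mem_erase.1 h').1 rfl⟩
    · exact mem_sdiff.2 ⟨hπ hxπ, fun h' => (mem_sdiff.1 (mem_of_mem_erase h')).2 hxπ⟩

/-- Condition R2/R3 vs R1/R4 of an ON demand `W = π + e + b`: `ρ(π + e + f) = 4` (the demand is off the plane `H`). -/
def d0c1 (N : Matroid α) [N.Finite] (b e f : α) (W : Finset α) : Prop :=
  rk N (insert f (insert e ((W.erase b).erase e))) = 4

/-- Condition R2: the complement `X ∖ π` is OFF. -/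
def d0c2 (N : Matroid α) [N.Finite] (b b' e f : α) (W : Finset α) : Prop :=
  rk N (insert b (insert b' (((((gr N).erase b).erase b').erase f).erase e \ (W.erase b).erase e))) = 5

/-- Condition R1: `π + f ∈ A`. -/
def d0c3 (N : Matroid α) [N.Finite] (b b' e f : α) (W : Finset α) : Prop :=
  rk N (insert f ((W.erase b).erase e)) = 3 ∧ rk N (insert e (((((gr N).erase b).erase b').erase f).erase e \ (W.erase b).erase e)) = 4

/-- Condition R4a with the fixed point `w₀`: the bi-basis `(X − π − w₀) + e + f` exists and the pair `X − π − w₀`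
is not an ON demand. -/
def d0c4 (N : Matroid α) [N.Finite] (b b' e f w₀ : α) (W : Finset α) : Prop :=
  rk N (insert f (insert e ((((((gr N).erase b).erase b').erase f).erase e \ (W.erase b).erase e).erase w₀))) = 4 ∧
    ¬ (insert b (insert e ((((((gr N).erase b).erase b').erase f).erase e \ (W.erase b).erase e).erase w₀)) ∈ biIndepSets N 4 ∧
      rk N (insert b (insert b' (insert e ((((((gr N).erase b).erase b').erase f).erase e \ (W.erase b).erase e).erase w₀)))) = 4)

/-- The ON demands at `(e, f)` avoiding `b′`. -/
noncomputable def d0DON (N : Matroid α) [N.Finite] (b' e f : α) : Finset (Finset α) :=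
  (biIndepSets N 4).filter (fun W => ((e ∈ W ∧ f ∉ W) ∧ b' ∉ W) ∧ ¬ (gr N \ W).erase b' ∈ biIndepSets N 4)

/-- **THE DATA OF AN ON DEMAND** in the vocabulary of `X = E₇ − e − f`. -/
theorem d0_demand_data (h : SeriesPair N b b') (hn : (gr N).card = 9) {e f : α} (hf : f ∈ gr N) (hef : e ≠ f)
    (heb : e ≠ b) (hfb : f ≠ b) (hfb' : f ≠ b') :
    ∀ W ∈ biIndepSets N 4, ((e ∈ W ∧ f ∉ W) ∧ b' ∉ W) → ¬ (gr N \ W).erase b' ∈ biIndepSets N 4 →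
      b ∈ W ∧ (W.erase b).erase e ⊆ ((((gr N).erase b).erase b').erase f).erase e ∧ ((W.erase b).erase e).card = 2 ∧
        insert e ((W.erase b).erase e) = W.erase b ∧ insert b (W.erase b) = W ∧
        rk N (insert e ((W.erase b).erase e)) = 3 ∧
        rk N (insert f (((((gr N).erase b).erase b').erase f).erase e \ (W.erase b).erase e)) = 4 ∧
        rk N (insert b (insert b' (insert e ((W.erase b).erase e)))) = 4 := by
  set X := ((((gr N).erase b).erase b').erase f).erase e with hXdef
  intro W hWs hPD hcW
  obtain ⟨hbW, hYE, heY, hfY, hY3, hYr, hYc, hYon⟩ := demand_on_data h hn heb hWs hPD hcW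
  have hπX : (W.erase b).erase e ⊆ X := by
    intro x hx
    rw [mem_erase] at hx
    exact mem_erase.2 ⟨hx.1, mem_erase.2 ⟨fun h' => hfY (by rw [← h']; exact hx.2), hYE hx.2⟩⟩
  have hπ2 : ((W.erase b).erase e).card = 2 := by rw [card_erase_of_mem heY, hY3]
  have hYeq : insert e ((W.erase b).erase e) = W.erase b := insert_erase heY
  refine ⟨hbW, hπX, hπ2, hYeq, insert_erase hbW, by rw [hYeq]; exact hYr, ?_, by rw [hYeq]; exact hYon⟩
  rw [← E7_sdiff_insert_e_eq hf hef hfb hfb' hπX, hYeq]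
  exact hYc

/-- **THE CLASSIFICATION OF AN ON DEMAND**: off `H` (`ρ(π + e + f) = 4`) or inside `H`. -/
theorem d0_demand_class (h : SeriesPair N b b') (hR : rk N (gr N) = 5) (hE7 : rk N (((gr N).erase b).erase b') = 4)
    (hnl : ∀ S : Finset α, S ⊆ ((gr N).erase b).erase b' → rk N (insert b (insert b' S)) ≤ 3 → rk N S ≤ 1)
    {e f : α} (he : e ∈ gr N) (hf : f ∈ gr N) (hef : e ≠ f) (heb : e ≠ b) (heb' : e ≠ b') (hfb : f ≠ b) (hfb' : f ≠ b')
    (hef2 : rk N {e, f} = 2)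
    {H : Finset α} (hH : H ⊆ ((gr N).erase b).erase b') (heH : e ∈ H) (hfH : f ∈ H) (hH3 : rk N H = 3)
    (hHon : rk N (insert b (insert b' H)) = 4)
    (hHfl : ∀ z ∈ ((gr N).erase b).erase b', z ∉ H → rk N (insert z H) = 4) :
    ∀ π : Finset α, π ⊆ ((((gr N).erase b).erase b').erase f).erase e → π.card = 2 → rk N (insert e π) = 3 →
      rk N (insert b (insert b' (insert e π))) = 4 → ¬ rk N (insert f (insert e π)) = 4 →
      rk N (insert f (insert e π)) = 3 ∧ insert e π ⊆ H := by
  have hXE : ((((gr N).erase b).erase b').erase f).erase e ⊆ ((gr N).erase b).erase b' :=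
    (erase_subset _ _).trans (erase_subset _ _)
  have heE : e ∈ ((gr N).erase b).erase b' := mem_erase.2 ⟨heb', mem_erase.2 ⟨heb, he⟩⟩
  have hfE : f ∈ ((gr N).erase b).erase b' := mem_erase.2 ⟨hfb', mem_erase.2 ⟨hfb, hf⟩⟩
  have heX : e ∉ ((((gr N).erase b).erase b').erase f).erase e := fun h' => (mem_erase.1 h').1 rfl
  have hfX : f ∉ ((((gr N).erase b).erase b').erase f).erase e := fun h' => (mem_erase.1 (mem_erase.1 h').2).1 rfl
  intro π hπX hπ2 hYr hYon hne4
  have hfY3 : rk N (insert f (insert e π)) = 3 := by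
    have h1 : rk N (insert e π) ≤ rk N (insert f (insert e π)) := rk_mono' (M := N) (subset_insert _ _)
    have h2 : rk N (insert f (insert e π)) ≤ 4 := by
      have := rk_le_card' (M := N) (insert f (insert e π))
      rw [card_insert_of_notMem (fun h' => (mem_insert.1 h').elim (fun h2 => hef h2.symm)
        (fun h2 => hfX (hπX h2))), card_insert_of_notMem (fun h' => heX (hπX h')), hπ2] at this
      exact this
    omega
  refine ⟨hfY3, ?_⟩
  have hS := subset_H_of_on_ef h hR hE7 hnl hef2 hH heH hfH hH3 hHon hHfl
    (S := insert f (insert e π)) (insert_subset hfE (insert_subset heE (hπX.trans hXE)))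
    (mem_insert_of_mem (mem_insert_self _ _)) (mem_insert_self _ _)
    (on_insert_f_of_on hf hfb hfb' hYr hfY3 hYon)
  exact (subset_insert _ _).trans hS

/-- `ρ(X ∖ π) = 3` when `(X ∖ π) + f` has rank `4`. -/
theorem d0_S3 (h : SeriesPair N b b') (hn : (gr N).card = 9) {e f : α} (he : e ∈ gr N) (hf : f ∈ gr N) (hef : e ≠ f)
    (heb : e ≠ b) (heb' : e ≠ b') (hfb : f ≠ b) (hfb' : f ≠ b') :
    ∀ π : Finset α, π ⊆ ((((gr N).erase b).erase b').erase f).erase e → π.card = 2 →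
      rk N (insert f (((((gr N).erase b).erase b').erase f).erase e \ π)) = 4 → rk N (((((gr N).erase b).erase b').erase f).erase e \ π) = 3 := by
  have hb : b ∈ gr N := h.1; have hb' : b' ∈ gr N := h.2.1; have hbb' : b ≠ b' := h.2.2.1
  have heE : e ∈ ((gr N).erase b).erase b' := mem_erase.2 ⟨heb', mem_erase.2 ⟨heb, he⟩⟩
  have hfE : f ∈ ((gr N).erase b).erase b' := mem_erase.2 ⟨hfb', mem_erase.2 ⟨hfb, hf⟩⟩
  have hE7c : (((gr N).erase b).erase b').card = 7 := by
    rw [card_erase_of_mem (mem_erase.2 ⟨hbb'.symm, hb'⟩), card_erase_of_mem hb, hn]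
  have hXc : (((((gr N).erase b).erase b').erase f).erase e).card = 5 := by
    rw [card_erase_of_mem (mem_erase.2 ⟨hef, heE⟩), card_erase_of_mem hfE, hE7c]
  have hfX : f ∉ ((((gr N).erase b).erase b').erase f).erase e := fun h' => (mem_erase.1 (mem_erase.1 h').2).1 rfl
  set X := ((((gr N).erase b).erase b').erase f).erase e with hXdef
  intro π hπX hπ2 hYc
  have hSc : (X \ π).card = 3 := by rw [card_sdiff_of_subset hπX, hXc, hπ2]
  have hc : (insert f (X \ π)).card = 4 := by
    rw [card_insert_of_notMem (fun h' => hfX (mem_sdiff.1 h').1), hSc]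
  rw [rk_eq_card_of_subset_of_rk_eq_card (M := N) (subset_insert f _) (by rw [hYc, hc]), hSc]

/-- **RULE R1**: the demands `π + e + b` in `H` with `π + f ∈ A` inject into the ON targets `π + f + b`. -/
theorem d0_injR1 (hn : (gr N).card = 9) (hR : rk N (gr N) = 5)
    (_hcf : ∀ x ∈ gr N, rk N ((gr N).erase x) = 5) (h : SeriesPair N b b')
    {e f : α} (he : e ∈ gr N) (hf : f ∈ gr N) (hef : e ≠ f) (heb : e ≠ b) (heb' : e ≠ b') (hfb : f ≠ b) (hfb' : f ≠ b')
    (hE7 : rk N (((gr N).erase b).erase b') = 4)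
    (hnl : ∀ S : Finset α, S ⊆ ((gr N).erase b).erase b' → rk N (insert b (insert b' S)) ≤ 3 → rk N S ≤ 1)
    (_he1 : ∀ y ∈ ((((gr N).erase b).erase b').erase f).erase e, rk N {e, y} = 2)
    (_hf1 : ∀ y ∈ ((((gr N).erase b).erase b').erase f).erase e, rk N {f, y} = 2)
    (hef2 : rk N {e, f} = 2) (_hX : rk N (((((gr N).erase b).erase b').erase f).erase e) = 4)
    {H : Finset α} (hH : H ⊆ ((gr N).erase b).erase b') (heH : e ∈ H) (hfH : f ∈ H) (hH3 : rk N H = 3)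
    (hHon : rk N (insert b (insert b' H)) = 4)
    (hHfl : ∀ z ∈ ((gr N).erase b).erase b', z ∉ H → rk N (insert z H) = 4)
    {w₀ : α} (hw₀ : w₀ ∈ ((((gr N).erase b).erase b').erase f).erase e) (_hw₀H : w₀ ∉ H) :
    ((d0DON N b' e f).filter (fun W => ¬ d0c1 N b e f W ∧ d0c3 N b b' e f W)).card ≤
      ((biIndepSets N 4).filter (fun W => (f ∈ W ∧ b' ∉ W) ∧ (e ∉ W ∧ b ∈ W ∧ ¬ (gr N \ W).erase b' ∈ biIndepSets N 4))).card := by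
  classical
  have hb : b ∈ gr N := h.1; have hb' : b' ∈ gr N := h.2.1; have hbb' : b ≠ b' := h.2.2.1
  have hXE : ((((gr N).erase b).erase b').erase f).erase e ⊆ ((gr N).erase b).erase b' :=
    (erase_subset _ _).trans (erase_subset _ _)
  have heE : e ∈ ((gr N).erase b).erase b' := mem_erase.2 ⟨heb', mem_erase.2 ⟨heb, he⟩⟩
  have hfE : f ∈ ((gr N).erase b).erase b' := mem_erase.2 ⟨hfb', mem_erase.2 ⟨hfb, hf⟩⟩
  have hE7c : (((gr N).erase b).erase b').card = 7 := by
    rw [card_erase_of_mem (mem_erase.2 ⟨hbb'.symm, hb'⟩), card_erase_of_mem hb, hn]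
  have hXc : (((((gr N).erase b).erase b').erase f).erase e).card = 5 := by
    rw [card_erase_of_mem (mem_erase.2 ⟨hef, heE⟩), card_erase_of_mem hfE, hE7c]
  have heX : e ∉ ((((gr N).erase b).erase b').erase f).erase e := fun h' => (mem_erase.1 h').1 rfl
  have hfX : f ∉ ((((gr N).erase b).erase b').erase f).erase e := fun h' => (mem_erase.1 (mem_erase.1 h').2).1 rfl
  have hw₀E : w₀ ∈ ((gr N).erase b).erase b' := hXE hw₀
  have hdata := d0_demand_data h hn hf hef heb hfb hfb' (e := e)
  have hclass := d0_demand_class h hR hE7 hnl he hf hef heb heb' hfb hfb' hef2 hH heH hfH hH3 hHon hHfl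
  have hS3 := d0_S3 h hn he hf hef heb heb' hfb hfb'
  set X := ((((gr N).erase b).erase b').erase f).erase e with hXdef
  apply card_le_card_of_injOn (fun W => insert b (insert f ((W.erase b).erase e)))
  · intro W hW
    simp only [d0DON, mem_coe, mem_filter] at hW
    obtain ⟨⟨hWs, hPD, hcW⟩, hnc₁, hc₃⟩ := hW
    obtain ⟨hbW, hπX, hπ2, hYeq, hWeq, hYr, hYc, hYon⟩ := hdata W hWs hPD hcW
    obtain ⟨hfY3, hπH⟩ := hclass _ hπX hπ2 hYr hYon hnc₁
    obtain ⟨him, hon⟩ := r1_image h hn he hf hef heb heb' hfb hfb' hπX hπ2 hYr hYon hfY3 hc₃.1 hc₃.2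
    have hfπ : f ∉ (W.erase b).erase e := fun h' => hfX (hπX h')
    have heπ : e ∉ (W.erase b).erase e := fun h' => heX (hπX h')
    have hb'π : b' ∉ (W.erase b).erase e := fun h' => hPD.2 (mem_of_mem_erase (mem_of_mem_erase h'))
    have hfπE : insert f ((W.erase b).erase e) ⊆ ((gr N).erase b).erase b' := insert_subset hfE (hπX.trans hXE)
    simp only [mem_coe, mem_filter]
    refine ⟨him, ⟨mem_insert_of_mem (mem_insert_self _ _), ?_⟩, ?_, mem_insert_self _ _, ?_⟩
    · intro h'
      rcases mem_insert.1 h' with h2 | h2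
      · exact hbb' h2.symm
      · rcases mem_insert.1 h2 with h3 | h3
        · exact hfb' h3.symm
        · exact hb'π h3
    · intro h'
      rcases mem_insert.1 h' with h2 | h2
      · exact heb h2
      · rcases mem_insert.1 h2 with h3 | h3
        · exact hef h3
        · exact heπ h3
    · intro hc
      have e3 : (gr N \ insert b (insert f ((W.erase b).erase e))).erase b' = insert e (X \ (W.erase b).erase e) := by
        rw [sdiff_insert_b_eq hb' hbb' hfπE, erase_insert (fun h' => (mem_erase.1 (mem_sdiff.1 h').1).1 rfl),
          E7_sdiff_insert_f_eq he hef heb heb' hπX]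
      rw [e3] at hc
      have hsE : insert e (X \ (W.erase b).erase e) ⊆ ((gr N).erase b).erase b' :=
        insert_subset heE (sdiff_subset.trans hXE)
      have hs4 : (insert e (X \ (W.erase b).erase e)).card = 4 := by
        rw [card_insert_of_notMem (fun h' => heX (mem_sdiff.1 h').1), card_sdiff_of_subset hπX, hXc, hπ2]
      have e4 : ((gr N).erase b).erase b' \ insert e (X \ (W.erase b).erase e) = insert f ((W.erase b).erase e) := by
        rw [← E7_sdiff_insert_f_eq he hef heb heb' hπX, Finset.sdiff_sdiff_eq_self hfπE]
      rw [mem_biIndepSets_iff_of_subset_E7 h hn hsE hs4, e4] at hc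
      omega
  · intro W₁ hW₁ W₂ hW₂ heq
    simp only [d0DON, mem_coe, mem_filter] at hW₁ hW₂
    obtain ⟨hb₁, hπ₁, -, hYeq₁, hWeq₁, -, -, -⟩ := hdata W₁ hW₁.1.1 hW₁.1.2.1 hW₁.1.2.2
    obtain ⟨hb₂, hπ₂, -, hYeq₂, hWeq₂, -, -, -⟩ := hdata W₂ hW₂.1.1 hW₂.1.2.1 hW₂.1.2.2
    have hbπ : ∀ Y : Finset α, b ∉ insert f ((Y.erase b).erase e) := fun Y h' =>
      (mem_insert.1 h').elim (fun h2 => hfb h2.symm) (fun h2 => (mem_erase.1 (mem_of_mem_erase h2)).1 rfl)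
    have hfπ₁ : f ∉ (W₁.erase b).erase e := fun h' => hW₁.1.2.1.1.2 (mem_of_mem_erase (mem_of_mem_erase h'))
    have hfπ₂ : f ∉ (W₂.erase b).erase e := fun h' => hW₂.1.2.1.1.2 (mem_of_mem_erase (mem_of_mem_erase h'))
    have e1 : (W₁.erase b).erase e = (W₂.erase b).erase e := by
      have h1 : insert f ((W₁.erase b).erase e) = insert f ((W₂.erase b).erase e) := by
        have := congrArg (fun S => S.erase b) heq
        simp only [erase_insert (hbπ _)] at this
        exact this
      rw [← erase_insert hfπ₁, ← erase_insert hfπ₂, h1]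
    rw [← hWeq₁, ← hWeq₂, ← hYeq₁, ← hYeq₂, e1]

end StarSharpD0G

end PercRepro.Cogirth
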